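import Summits.AtomisticToContinuum.FouriersLaw.Theses.OddSectorIrreversibility
import Literature.MathematicalPhysics.KineticTheory.LangevinChainGibbs
import Literature.Barriers.AtomisticToContinuum.HarmonicCrystalBallisticProofs

/-!
# OddResponseBound — the odd-sector pairing inequality, tightness of the power `N¹`, and the harmonic calibration floor (negative-side support)

Support lemmas for crux `OddSectorIrreversibility.OddResponseBound` (item stmt-AtomisticToContinuum-9140,
"SI": `a_N := N ∫ (h_N − h_N∘Θ)² dμ_T ≤ C`) from the standing disprover's work file
`Cruxes/OddResponseBound/Disproof.lean` §1–§2; all sorry-free, no new definitions.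

* §1 `four_mul_sq_integral_le`: for a `Θ`-invariant measure, an involutive measurable `Θ`, an odd
  `g ∈ L²` and `h ∈ L²`: `4 (∫ g h)² ≤ (∫ g²) · ∫ (h − h∘Θ)²` (Θ-transfer + Cauchy–Schwarz). This is the
  one inequality behind the route's `OddSufficiency` (with `g = J_tot`, `∫ J_tot h = D_N`) and, read
  backwards, the template of every lower bound on `a_N`: odd test functions `G_N` with
  `N (∫ G_N h_N)² / ∫ G_N² → ∞` refute SI. Phase-space form `oddResponse_floor`
  (`Θ = momentumReversal`): `4 N (∫ g h)²/V ≤ N ∫ (h − h∘Θ)²` whenever `∫ g² ≤ V` — with `g = J_tot`,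
  `V = cN`, `D_N → κ > 0` the right side is `≥ 4κ²/c`: the power `N¹` of SI cannot be raised.
* §2 harmonic calibration (load-bearing lemma for `0 < lam ∨ 0 < β`): the equal-temperature RLL
  Gaussian state `harmonicNESS ω₂ γ N T T` is momentum-reversal invariant
  (`measurePreserving_momentumReversal_harmonicNESS`, via `chainCov_self` and invariance of tilted
  measures, `measurePreserving_tilted`), and ANY `h ∈ L²(μ_T)` reproducing the first bond's current
  response of the RLL family (clause 3 of the crux predicate at `i = 0`; the flux is `c_N δ` exactly)
  has `N ∫ (h − h∘Θ)² ≥ 4 N c_N² / K` when `∫ j₀² dμ_T ≤ K` (`harmonic_oddResponse_floor`); since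
  `c_N → c_∞ > 0` (`tendsto_fluxCoeff`, `fluxLimit_pos`), under an `N`-uniform `K` every such `h`
  violates any prescribed bound for large `N` (`harmonic_oddResponse_exceeds`): the `lam = β = 0`
  analogue of SI fails as soon as the Gaussian response densities exist (numerically `a_N = 0.30 N²`
  at `ω₂ = γ = T = 1`, Disproof.lean §2).
Nothing here closes an item.
-/

noncomputable section

open MeasureTheory Filter Topology Set
open Literature.MathematicalPhysics.KineticTheory.HeatConduction

namespace Summit.AtomisticToContinuum.FouriersLaw.Theorems.OddResponseBound.Negative.OddPairing

/-! ## §1 the odd-sector pairing inequality (abstract) -/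

section OddPairing

variable {X : Type*} [MeasurableSpace X] {μ : Measure X}

/-- Cauchy–Schwarz for real square-integrable functions: `(∫ g k)² ≤ (∫ g²)(∫ k²)`
(discriminant proof). [folklore] -/
theorem sq_integral_mul_le {g k : X → ℝ} (hg : MemLp g 2 μ) (hk : MemLp k 2 μ) :
    (∫ x, g x * k x ∂μ) ^ 2 ≤ (∫ x, g x ^ 2 ∂μ) * ∫ x, k x ^ 2 ∂μ := by
  have hg2 : Integrable (fun x => g x ^ 2) μ := hg.integrable_sq
  have hk2 : Integrable (fun x => k x ^ 2) μ := hk.integrable_sq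
  have hgk : Integrable (fun x => g x * k x) μ := hg.integrable_mul hk
  set A := ∫ x, g x ^ 2 ∂μ with hA_def
  set B := ∫ x, g x * k x ∂μ with hB_def
  set C := ∫ x, k x ^ 2 ∂μ with hC_def
  have hA : 0 ≤ A := integral_nonneg fun x => sq_nonneg _
  have key : ∀ t : ℝ, 0 ≤ A * t ^ 2 - 2 * B * t + C := by
    intro t
    have h1 : 0 ≤ ∫ x, (t * g x - k x) ^ 2 ∂μ := integral_nonneg fun x => sq_nonneg _
    have h2 : ∫ x, (t * g x - k x) ^ 2 ∂μ = A * t ^ 2 - 2 * B * t + C := by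
      have hsplit : (fun x => (t * g x - k x) ^ 2) =
          fun x => (t ^ 2 * g x ^ 2 - 2 * t * (g x * k x)) + k x ^ 2 := by
        funext x; ring
      have i1 : Integrable (fun x => t ^ 2 * g x ^ 2 - 2 * t * (g x * k x)) μ :=
        (hg2.const_mul _).sub (hgk.const_mul _)
      rw [hsplit, integral_add i1 hk2, integral_sub (hg2.const_mul _) (hgk.const_mul _),
        integral_const_mul, integral_const_mul]
      ring
    linarith
  by_cases hA0 : A = 0
  · have hB : B = 0 := by
      by_contra hB
      have h := key ((C + 1) / (2 * B))
      have h' : (2 : ℝ) * B * ((C + 1) / (2 * B)) = C + 1 := by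
        field_simp
      rw [hA0, zero_mul, zero_sub, h'] at h
      linarith
    rw [hB, hA0]
    simp
  · have hApos : 0 < A := lt_of_le_of_ne hA (Ne.symm hA0)
    have h := key (B / A)
    have h3 : A * (B / A) ^ 2 - 2 * B * (B / A) + C = C - B ^ 2 / A := by
      field_simp
      ring
    rw [h3] at h
    have h4 : B ^ 2 / A ≤ C := by linarith
    rw [div_le_iff₀ hApos] at h4
    linarith [h4]

variable {Θ : X → X}

/-- Θ-transfer: for a `Θ`-invariant measure, an involutive measurable `Θ` and an odd `g`,
`∫ g · (h∘Θ) = −∫ g · h`. [folklore] -/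
theorem integral_mul_comp_eq_neg (hΘ : MeasurePreserving Θ μ μ) (hΘm : Measurable Θ)
    (hinv : Function.Involutive Θ) {g h : X → ℝ} (hodd : ∀ x, g (Θ x) = -g x) :
    ∫ x, g x * h (Θ x) ∂μ = -∫ x, g x * h x ∂μ := by
  have hemb : MeasurableEmbedding Θ :=
    (⟨⟨Θ, Θ, hinv.leftInverse, hinv.rightInverse⟩, hΘm, hΘm⟩ : X ≃ᵐ X).measurableEmbedding
  have key := hΘ.integral_comp hemb (fun y => -(g y * h y))
  simp only [hodd, neg_mul, neg_neg, integral_neg] at key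
  exact key

/-- The odd pairing identity `∫ g (h − h∘Θ) = 2 ∫ g h` (odd `g ∈ L²`, `h ∈ L²`, `Θ`-invariant `μ`).
[folklore] -/
theorem integral_mul_sub_comp (hΘ : MeasurePreserving Θ μ μ) (hΘm : Measurable Θ)
    (hinv : Function.Involutive Θ) {g h : X → ℝ} (hodd : ∀ x, g (Θ x) = -g x)
    (hg : MemLp g 2 μ) (hh : MemLp h 2 μ) :
    ∫ x, g x * (h x - h (Θ x)) ∂μ = 2 * ∫ x, g x * h x ∂μ := by
  have hgh : Integrable (fun x => g x * h x) μ := hg.integrable_mul hh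
  have hhΘ : MemLp (fun x => h (Θ x)) 2 μ := hh.comp_measurePreserving hΘ
  have hghΘ : Integrable (fun x => g x * h (Θ x)) μ := hg.integrable_mul hhΘ
  have hsplit : (fun x => g x * (h x - h (Θ x))) = fun x => g x * h x - g x * h (Θ x) := by
    funext x; ring
  rw [hsplit, integral_sub hgh hghΘ, integral_mul_comp_eq_neg hΘ hΘm hinv hodd]
  ring

/-- **Odd-sector pairing inequality**: `4 (∫ g h)² ≤ (∫ g²) · ∫ (h − h∘Θ)²` for a `Θ`-invariant
measure, involutive measurable `Θ`, odd `g ∈ L²`, `h ∈ L²`. [folklore] -/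
theorem four_mul_sq_integral_le (hΘ : MeasurePreserving Θ μ μ) (hΘm : Measurable Θ)
    (hinv : Function.Involutive Θ) {g h : X → ℝ} (hodd : ∀ x, g (Θ x) = -g x)
    (hg : MemLp g 2 μ) (hh : MemLp h 2 μ) :
    4 * (∫ x, g x * h x ∂μ) ^ 2 ≤ (∫ x, g x ^ 2 ∂μ) * ∫ x, (h x - h (Θ x)) ^ 2 ∂μ := by
  have hhΘ : MemLp (fun x => h (Θ x)) 2 μ := hh.comp_measurePreserving hΘ
  have hk : MemLp (fun x => h x - h (Θ x)) 2 μ := hh.sub hhΘ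
  have hcs := sq_integral_mul_le hg hk
  rw [integral_mul_sub_comp hΘ hΘm hinv hodd hg hh] at hcs
  nlinarith [hcs]

/-- Lower-bound form: `∫ g² ≤ V`, `0 < V` give `4 (∫ g h)² / V ≤ ∫ (h − h∘Θ)²`. [folklore] -/
theorem sq_integral_div_le_integral_sub_comp_sq (hΘ : MeasurePreserving Θ μ μ) (hΘm : Measurable Θ)
    (hinv : Function.Involutive Θ) {g h : X → ℝ} (hodd : ∀ x, g (Θ x) = -g x)
    (hg : MemLp g 2 μ) (hh : MemLp h 2 μ) {V : ℝ} (hV : 0 < V) (hgV : ∫ x, g x ^ 2 ∂μ ≤ V) :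
    4 * (∫ x, g x * h x ∂μ) ^ 2 / V ≤ ∫ x, (h x - h (Θ x)) ^ 2 ∂μ := by
  have h1 := four_mul_sq_integral_le hΘ hΘm hinv hodd hg hh
  have h0 : 0 ≤ ∫ x, (h x - h (Θ x)) ^ 2 ∂μ := integral_nonneg fun x => sq_nonneg _
  rw [div_le_iff₀ hV]
  calc 4 * (∫ x, g x * h x ∂μ) ^ 2 ≤ (∫ x, g x ^ 2 ∂μ) * ∫ x, (h x - h (Θ x)) ^ 2 ∂μ := h1
    _ ≤ V * ∫ x, (h x - h (Θ x)) ^ 2 ∂μ := mul_le_mul_of_nonneg_right hgV h0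
    _ = (∫ x, (h x - h (Θ x)) ^ 2 ∂μ) * V := mul_comm _ _

/-- Tilted measures inherit the invariance of the base measure under a symmetry of the tilt.
[folklore] -/
theorem measurePreserving_tilted (hΘ : MeasurePreserving Θ μ μ) (hemb : MeasurableEmbedding Θ)
    {f : X → ℝ} (hf : ∀ x, f (Θ x) = f x) : MeasurePreserving Θ (μ.tilted f) (μ.tilted f) := by
  refine ⟨hemb.measurable, Measure.ext fun s hs => ?_⟩
  rw [Measure.map_apply hemb.measurable hs, Measure.tilted, withDensity_apply _ (hemb.measurable hs),
    withDensity_apply _ hs]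
  have key := hΘ.setLIntegral_comp_preimage_emb hemb
    (fun x => ENNReal.ofReal (Real.exp (f x) / ∫ x, Real.exp (f x) ∂μ)) s
  simpa only [hf] using key

end OddPairing

/-! ## §1b phase space: tightness of the power `N¹`, and the refutation template -/

section PhaseSpaceFloor

variable {N : ℕ}

/-- Momentum reversal is an involution of phase space. [folklore] -/
theorem momentumReversal_involutive : Function.Involutive (momentumReversal N) := by
  intro x
  simp [momentumReversal_apply]

/-- **Floor / tightness lemma.** For any momentum-reversal-invariant measure `μ` on phase space, any
`h ∈ L²(μ)` and any odd test function `g ∈ L²(μ)` with `∫ g² ≤ V`: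
`4 N (∫ g h)² / V ≤ N · ∫ (h − h∘Θ)² dμ`. With `g = J_tot` (odd: `bondCurrent_neg_momentum`),
`∫ J_tot h = D_N → κ > 0` and `V = cN` (CurrentVarianceLinear) the left side tends to `4κ²/c > 0`: the
power `N¹` in `OddResponseBound` cannot be improved under Fourier's law; odd test functions with
`N (∫ g h)²/V → ∞` refute it. [folklore] -/
theorem oddResponse_floor (μ : Measure (PhaseSpace N))
    (hμ : MeasurePreserving (momentumReversal N) μ μ) {g h : PhaseSpace N → ℝ}
    (hodd : ∀ x, g (x.1, -x.2) = -g x) (hg : MemLp g 2 μ) (hh : MemLp h 2 μ) {V : ℝ} (hV : 0 < V)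
    (hgV : ∫ x, g x ^ 2 ∂μ ≤ V) :
    4 * (N : ℝ) * (∫ x, g x * h x ∂μ) ^ 2 / V ≤
      (N : ℝ) * ∫ x, (h x - h (x.1, -x.2)) ^ 2 ∂μ := by
  have hodd' : ∀ x, g (momentumReversal N x) = -g x := fun x => by
    rw [momentumReversal_apply]; exact hodd x
  have h1 := sq_integral_div_le_integral_sub_comp_sq hμ (momentumReversal N).measurable
    momentumReversal_involutive hodd' hg hh hV hgV
  simp only [momentumReversal_apply] at h1
  have hN : (0 : ℝ) ≤ N := Nat.cast_nonneg N
  calc 4 * (N : ℝ) * (∫ x, g x * h x ∂μ) ^ 2 / V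
      = (N : ℝ) * (4 * (∫ x, g x * h x ∂μ) ^ 2 / V) := by ring
    _ ≤ (N : ℝ) * ∫ x, (h x - h (x.1, -x.2)) ^ 2 ∂μ := mul_le_mul_of_nonneg_left h1 hN

end PhaseSpaceFloor

/-! ## §2 harmonic calibration: the `lam = β = 0` analogue of SI fails -/

section Harmonic

variable {ω₂ γ : ℝ}

/-- The precision matrix of the equal-temperature RLL state is block diagonal,
`C(T,T)⁻¹ = [[Φ/T, 0], [0, 1/T]]` (Gibbs at temperature `T`). [Bonetto–Lebowitz–Lukkarinen 2004, §2]
[folklore] -/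
theorem chainCov_self_inv (hω : 0 < ω₂) (hγ : 0 < γ) (N : ℕ) {T : ℝ} (hT : 0 < T) :
    (chainCov ω₂ γ N T T)⁻¹ =
      Matrix.fromBlocks (T⁻¹ • forceMatrix ω₂ N) 0 0 (T⁻¹ • (1 : Matrix (Fin N) (Fin N) ℝ)) := by
  rw [chainCov_self hω hγ N T]
  apply Matrix.inv_eq_right_inv
  have hunit : IsUnit (forceMatrix ω₂ N).det :=
    (Matrix.isUnit_iff_isUnit_det _).mp (forceMatrix_posDef hω N).isUnit
  have h2 : (forceMatrix ω₂ N)⁻¹ * forceMatrix ω₂ N = 1 := Matrix.nonsing_inv_mul _ hunit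
  rw [gibbsCov, Matrix.smul_mul, Matrix.fromBlocks_multiply]
  simp only [Matrix.mul_smul, Matrix.zero_mul, Matrix.mul_zero, add_zero, zero_add, Matrix.one_mul,
    h2, smul_zero]
  ext a b
  rcases a with i | i <;> rcases b with j | j <;>
    simp [Matrix.one_apply, hT.ne']

/-- A block-diagonal quadratic form is even under momentum reversal. [folklore] -/
theorem quadForm_fromBlocks_diag_neg {N : ℕ} (A D : Matrix (Fin N) (Fin N) ℝ) (x : PhaseSpace N) :
    quadForm (Matrix.fromBlocks A 0 0 D) (x.1, -x.2) = quadForm (Matrix.fromBlocks A 0 0 D) x := by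
  simp only [quadForm, flat, Matrix.fromBlocks_mulVec, Sum.elim_comp_inl, Sum.elim_comp_inr,
    Matrix.zero_mulVec, add_zero, zero_add, neg_zero, sumElim_dotProduct_sumElim, Matrix.mulVec_neg,
    dotProduct_neg, neg_dotProduct, neg_neg]

/-- **The equal-temperature RLL state is momentum-reversal invariant** (it is the Gibbs Gaussian
`∝ exp(−(qᵀΦq + pᵀp)/2T)`). [Bonetto–Lebowitz–Lukkarinen 2004, §2] [folklore] -/
theorem measurePreserving_momentumReversal_harmonicNESS (hω : 0 < ω₂) (hγ : 0 < γ) (N : ℕ)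
    {T : ℝ} (hT : 0 < T) :
    MeasurePreserving (momentumReversal N) (harmonicNESS ω₂ γ N T T) (harmonicNESS ω₂ γ N T T) := by
  rw [harmonicNESS, chainCov_self_inv hω hγ N hT, gaussMeasure]
  exact measurePreserving_tilted (measurePreserving_momentumReversal N)
    (momentumReversal N).measurableEmbedding
    (fun x => by rw [momentumReversal_apply, quadForm_fromBlocks_diag_neg])

/-- **Harmonic calibration floor.** For the RLL family `harmonicNESS ω₂ γ N` at equal temperatures
`T`, `N ≥ 2`, EVERY `h ∈ L²(μ_T)` whose pairing reproduces the first bond's current response (clause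
3 of the crux predicate at `i = 0`; the mean flux at `(T+δ/2, T−δ/2)` is `c_N δ` exactly, so the
clause forces `∫ j₀ h dμ_T = c_N` by uniqueness of limits along `𝓝[≠] 0`) satisfies
`4 N c_N² / K ≤ N ∫ (h − h∘Θ)² dμ_T` whenever `∫ j₀² dμ_T ≤ K`. [folklore] -/
theorem harmonic_oddResponse_floor (hω : 0 < ω₂) (hγ : 0 < γ) {N : ℕ} (hN : 2 ≤ N) {T : ℝ}
    (hT : 0 < T) {h : PhaseSpace N → ℝ} (hh : MemLp h 2 (harmonicNESS ω₂ γ N T T))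
    (hcur : Tendsto (fun δ : ℝ =>
        ((∫ x, (pinnedChain ω₂ 0 0 γ).bondCurrent N ⟨0, by omega⟩ x
            ∂(harmonicNESS ω₂ γ N (T + δ / 2) (T - δ / 2))) -
          ∫ x, (pinnedChain ω₂ 0 0 γ).bondCurrent N ⟨0, by omega⟩ x ∂(harmonicNESS ω₂ γ N T T)) / δ)
      (𝓝[≠] 0) (𝓝 (∫ x, (pinnedChain ω₂ 0 0 γ).bondCurrent N ⟨0, by omega⟩ x * h x
        ∂(harmonicNESS ω₂ γ N T T))))
    {K : ℝ} (hK : 0 < K)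
    (hj : MemLp ((pinnedChain ω₂ 0 0 γ).bondCurrent N ⟨0, by omega⟩) 2 (harmonicNESS ω₂ γ N T T))
    (hjK : ∫ x, (pinnedChain ω₂ 0 0 γ).bondCurrent N ⟨0, by omega⟩ x ^ 2 ∂(harmonicNESS ω₂ γ N T T) ≤ K) :
    4 * (N : ℝ) * (fluxCoeff ω₂ γ N) ^ 2 / K ≤
      (N : ℝ) * ∫ x, (h x - h (x.1, -x.2)) ^ 2 ∂(harmonicNESS ω₂ γ N T T) := by
  have h01 : (⟨0, by omega⟩ : Fin N).val + 1 < N := by simp; omega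
  -- the pairing of `h` with the first bond current is the flux coefficient
  have hresp : ∫ x, (pinnedChain ω₂ 0 0 γ).bondCurrent N ⟨0, by omega⟩ x * h x
      ∂(harmonicNESS ω₂ γ N T T) = fluxCoeff ω₂ γ N := by
    have hEq : (fun δ : ℝ =>
        ((∫ x, (pinnedChain ω₂ 0 0 γ).bondCurrent N ⟨0, by omega⟩ x
            ∂(harmonicNESS ω₂ γ N (T + δ / 2) (T - δ / 2))) -
          ∫ x, (pinnedChain ω₂ 0 0 γ).bondCurrent N ⟨0, by omega⟩ x ∂(harmonicNESS ω₂ γ N T T)) / δ)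
        =ᶠ[𝓝[≠] 0] fun _ => fluxCoeff ω₂ γ N := by
      have hball : Set.Ioo (-T) T ∈ 𝓝 (0 : ℝ) := Ioo_mem_nhds (by linarith) hT
      filter_upwards [mem_nhdsWithin_of_mem_nhds hball, self_mem_nhdsWithin] with δ hδ hδ0
      have hL : (0 : ℝ) < T + δ / 2 := by obtain ⟨h1, h2⟩ := hδ; linarith
      have hR : (0 : ℝ) < T - δ / 2 := by obtain ⟨h1, h2⟩ := hδ; linarith
      have hδ0' : δ ≠ 0 := hδ0
      rw [integral_bondCurrent_harmonicNESS_eq_fluxCoeff' hω hγ hL hR _ h01,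
        integral_bondCurrent_harmonicNESS_eq_fluxCoeff' hω hγ hT hT _ h01]
      field_simp
      ring
    exact tendsto_nhds_unique (hcur.congr' hEq) tendsto_const_nhds
  have hfloor := oddResponse_floor (harmonicNESS ω₂ γ N T T)
    (measurePreserving_momentumReversal_harmonicNESS hω hγ N hT)
    (fun x => (pinnedChain ω₂ 0 0 γ).bondCurrent_neg_momentum N ⟨0, by omega⟩ x) hj hh hK hjK
  rwa [hresp] at hfloor

/-- **The `lam = β = 0` analogue of SI fails as soon as response densities exist.** Given an
`N`-uniform bound `K` on the equal-temperature second moment of the first bond current (a Gaussian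
fourth moment, `= ½ T² (e₁−e₀)ᵀΦ_N⁻¹(e₁−e₀) ≤ T²/ω₂`), for every `C` there is `N₀` such that for ALL
`N ≥ N₀`, EVERY `h ∈ L²(μ_T)` reproducing the first bond's current response of the RLL family has
`C < N ∫ (h − h∘Θ)² dμ_T` (`c_N → c_∞ > 0`: `tendsto_fluxCoeff`, `fluxLimit_pos`). Numerically
`a_N = 0.30 N²` (`ω₂ = γ = T = 1`). Hence any proof of `OddResponseBound` must use `0 < lam ∨ 0 < β`.
[folklore] -/
theorem harmonic_oddResponse_exceeds (hω : 0 < ω₂) (hγ : 0 < γ) {T : ℝ} (hT : 0 < T) {K : ℝ}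
    (hK : ∀ (N : ℕ) (hN : 2 ≤ N),
      MemLp ((pinnedChain ω₂ 0 0 γ).bondCurrent N ⟨0, by omega⟩) 2 (harmonicNESS ω₂ γ N T T) ∧
      ∫ x, (pinnedChain ω₂ 0 0 γ).bondCurrent N ⟨0, by omega⟩ x ^ 2 ∂(harmonicNESS ω₂ γ N T T) ≤ K)
    (C : ℝ) :
    ∃ N₀ : ℕ, ∀ (N : ℕ) (hN : 2 ≤ N), N₀ ≤ N → ∀ h : PhaseSpace N → ℝ,
      MemLp h 2 (harmonicNESS ω₂ γ N T T) →
      Tendsto (fun δ : ℝ =>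
        ((∫ x, (pinnedChain ω₂ 0 0 γ).bondCurrent N ⟨0, by omega⟩ x
            ∂(harmonicNESS ω₂ γ N (T + δ / 2) (T - δ / 2))) -
          ∫ x, (pinnedChain ω₂ 0 0 γ).bondCurrent N ⟨0, by omega⟩ x ∂(harmonicNESS ω₂ γ N T T)) / δ)
        (𝓝[≠] 0) (𝓝 (∫ x, (pinnedChain ω₂ 0 0 γ).bondCurrent N ⟨0, by omega⟩ x * h x
          ∂(harmonicNESS ω₂ γ N T T))) →
      C < (N : ℝ) * ∫ x, (h x - h (x.1, -x.2)) ^ 2 ∂(harmonicNESS ω₂ γ N T T) := by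
  set c := fluxLimit ω₂ γ with hc
  have hcpos : 0 < c := fluxLimit_pos hω hγ
  have hKpos : 0 < max K 1 := lt_of_lt_of_le one_pos (le_max_right K 1)
  have hev1 : ∀ᶠ N : ℕ in atTop, c / 2 < fluxCoeff ω₂ γ N :=
    (tendsto_fluxCoeff hω hγ).eventually_const_lt (by linarith)
  have hev3 : ∀ᶠ N : ℕ in atTop, (C + 1) * max K 1 / c ^ 2 < (N : ℝ) :=
    (tendsto_natCast_atTop_atTop (R := ℝ)).eventually_gt_atTop _
  obtain ⟨N₀, hN₀⟩ := (hev1.and hev3).exists_forall_of_atTop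
  refine ⟨N₀, fun N hN hNN₀ h hh hcur => ?_⟩
  obtain ⟨hN1, hN3⟩ := hN₀ N hNN₀
  obtain ⟨hjmem, hjK⟩ := hK N hN
  have hjK' := hjK.trans (le_max_left K 1)
  have hfloor := harmonic_oddResponse_floor hω hγ hN hT hh hcur hKpos hjmem hjK'
  have h5 : C + 1 < (N : ℝ) * c ^ 2 / max K 1 := by
    rw [lt_div_iff₀ hKpos]
    have h3 := hN3
    rw [div_lt_iff₀ (by positivity)] at h3
    linarith
  have h6 : (N : ℝ) * c ^ 2 / max K 1 ≤ 4 * (N : ℝ) * (fluxCoeff ω₂ γ N) ^ 2 / max K 1 := by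
    apply div_le_div_of_nonneg_right _ hKpos.le
    have hN0 : (0 : ℝ) ≤ N := Nat.cast_nonneg N
    have hsq : c ^ 2 ≤ 4 * (fluxCoeff ω₂ γ N) ^ 2 := by nlinarith [hN1, hcpos]
    nlinarith [hsq, hN0]
  linarith

end Harmonic

end Summit.AtomisticToContinuum.FouriersLaw.Theorems.OddResponseBound.Negative.OddPairing
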